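import Summits.ResolutionOfSingularities.ResolutionOfSingularities.Theorems.HilbertSamuelEliminationSigmaMaxModificationsCorridor3WLadderSegmentsExtractU
import HarnessLib

/-!
# [OURS · L1 W4.2] CLAUSE (iii) OF CJS Def. 6.38 FOR THE REPAIRED UNIT TOWER — `C_q = φ_q⁻¹(x) ∩ X_q(ν)` — DISCHARGED from the near-locus
# geometry, and the recognition row REDUCED TO PURE GEOMETRY (`Seg.UnitGeometryAtQM`)
# (crux `SigmaMaxModifications` stmt-ResolutionOfSingularities-18506; conjunct `SigmaMaxModificationsCorridor3` stmt-…-19249; line `w_ladder`; RECOGNITION)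

Stub worker res-L1-w42-stub-1 (gen 4). Helper file `--supports stmt-ResolutionOfSingularities-19249 --as helper`; kernel only, no named fact.

* `Seg.unitTowerU_C_eq_nearLocus` — at every kept stage `q < unitLen` of the repaired unit tower based at a blown-up isolated stage `b`, **the
  centre IS the near locus over the initial point** (CJS Def. 6.38 (iii)): the genuine canonical centre contains the near locus over `x_b`
  (`…SegmentsHEmp`, from (Dich)/(RegN)), and a point of the centre over a generization of `x_b` is a near point (isolation of `x_b`).
* `Seg.unitCentreDiscipline_of_geometry` — the centre discipline of `unitTowerU b` from (iii) and the three remaining GEOMETRIC clauses taken as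
  hypotheses: (ii)′ `C_1 = ℙ(Dir_x)`, (iv) `C_{j+1} ⥲ C_j`, (v) non-surjectivity at the end.
* `Seg.UnitGeometryAtQM p Q` — THE RECOGNITION ROW AS PURE GEOMETRY (binder list of `UnitTowerExtractionLocAtQM`; at every blown-up isolated
  stage: (Dich)/(RegN) inside the unit, and (ii)′ (iv) (v) for the repaired unit tower), and
  **`Seg.unitRecognitionAtQMU_of_geometry : UnitGeometryAtQM p Q → UnitRecognitionAtQMU p Q`** — so
  `Moving.unitTowerExtractionLocQM_of_recognitionU (unitRecognitionAtQMU_of_geometry h)` closes the char row's `hext` from geometry alone.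

OURS bookkeeping; NOT a statement of the manuscript [Hironaka2017] nor of [CossartJannsenSaito2020]. AI-written; AI review is weaker than expert
review.

References: V. Cossart, U. Jannsen, S. Saito, LNM 2270 (2020), Def. 6.34 (ii), Def. 6.38 (ii)–(v), Lemma 6.33, p. 105, p. 107 [CossartJannsenSaito2020].
-/

noncomputable section

set_option linter.dupNamespace false -- namespace `…Corridor3.Moving` re-enters `…Corridor3` (module convention of the Moving files)

open CategoryTheory AlgebraicGeometry TopologicalSpace Topology IsLocalRing
open Literature.AlgebraicGeometry.Resolution Literature.RingTheory.HilbertSamuel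
open Literature.AlgebraicGeometry.CossartJannsenSaito2020
open Summit.ResolutionOfSingularities.ResolutionOfSingularities.Theorems.CampaignW42
open Summit.ResolutionOfSingularities.ResolutionOfSingularities.Theorems.SigmaMaxModificationsCorridor3.Helpers

namespace Summit.ResolutionOfSingularities.ResolutionOfSingularities.Theorems.SigmaMaxModificationsCorridor3.Moving

namespace Seg

section Unit

variable {R : ∀ S : Scheme.{0}, CentreSeq S → Prop} {N : ℕ} {ν : ℕ → ℕ} {k : Type} [Field k]
  {c : ℕ → MarkedStage.{0}} (hc : ∀ n, CanonicalNearStep R N ν (c n) (c (n + 1))) (hRf : OracleFunctional R) (hRa : OracleAdmissible R)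
  (hν : ν ≠ iterPSum N Phi) (h0 : Helpers.CycleInv k N ν (c 0)) (hgen : ∀ n, ∃ m, n ≤ m ∧ (c m).IsBlownUp R N ν)
  (hBG : ∀ n, ∃ m, n ≤ m ∧ (c m).IsBlownUp R N ν ∧ Iso N (c m))
  {p : ℕ} {X : Scheme.{0}} [IsLocallyNoetherian X] {x : X} (hX : IsMaximalOrigin p N ν X x)
  (hreach : Reaches R N ν (MarkedStage.init X x) (c 0))

include hX hreach in
/-- **The localised centre is the localised near locus as soon as the centre contains the near locus** (base isolated in its stratum): a point
of `C_{b+n}` over a generization of `x_b` is a near point over `x_b`. [cite: CossartJannsenSaito2020, Def. 6.38 (iii), p. 107] -/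
theorem locTower_C_eq_preimage_nearLocus (b : ℕ)
    (hU : ∃ U : Set (c b).W, IsOpen U ∧ (c b).pt ∈ U ∧ U ∩ Scheme.hsStratum (c b).W N ν ⊆ {(c b).pt}) (n : ℕ)
    (hNC : (upTower hc hRa hν h0 b).nearLocus N (c b).pt n ⊆ (upTower hc hRa hν h0 b).C n) :
    (locTower hc hRa hν h0 b).C n = (locι hc hRa hν h0 b n).base ⁻¹' (upTower hc hRa hν h0 b).nearLocus N (c b).pt n := by
  haveI : IsLocallyNoetherian ((upTower hc hRa hν h0 b).X 0) := (upTower hc hRa hν h0 b).ln 0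
  haveI := flat_fromSpecStalk ((upTower hc hRa hν h0 b).X 0) ((c b).pt : (upTower hc hRa hν h0 b).X 0)
  show (locι hc hRa hν h0 b n).base ⁻¹' (upTower hc hRa hν h0 b).C n = _
  apply Set.Subset.antisymm _ (Set.preimage_mono hNC)
  intro y hy
  have hCsub : (upTower hc hRa hν h0 b).C n ⊆ Scheme.hsStratum (c (b + n)).W N ν :=
    (Helpers.chainCentre_package (shiftStep hc b) hRa hν (cycleInv_at hc hRa hν h0 b) n).2.1
  have e : ((upTower hc hRa hν h0 b).phi n).base ((locι hc hRa hν h0 b n).base y) =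
      (((upTower hc hRa hν h0 b).X 0).fromSpecStalk ((c b).pt : (upTower hc hRa hν h0 b).X 0)).base (((locTower hc hRa hν h0 b).phi n).base y) :=
    (upTower hc hRa hν h0 b).phi_bcι_apply _ n y
  have hrange : ((upTower hc hRa hν h0 b).phi n).base ((locι hc hRa hν h0 b n).base y) ∈
      Set.range (((upTower hc hRa hν h0 b).X 0).fromSpecStalk ((c b).pt : (upTower hc hRa hν h0 b).X 0)).base := by
    rw [e]; exact ⟨_, rfl⟩
  rw [Scheme.range_fromSpecStalk] at hrange
  exact mem_nearLocus_of_mem_hsStratum_of_specializes hc hRa hν h0 hX hreach b hU n _ (hCsub hy) hrange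

include hRf hX hreach in
/-- **CLAUSE (iii) OF Def. 6.38 FOR THE REPAIRED UNIT TOWER**: at every kept stage `q < unitLen` of `unitTowerU b` (base `b` blown up at a
marked point isolated in the Hilbert–Samuel locus), the centre IS the near locus over the initial point — given (Dich)/(RegN) inside the unit.
[cite: CossartJannsenSaito2020, Def. 6.38 (iii)] -/
theorem unitTowerU_C_eq_nearLocus (b : ℕ) (hb : (c b).IsBlownUp R N ν) (hiso : Iso N (c b))
    (hDich : ∀ n, 0 < n → n < Seg.relIdxU hgen hBG b (Seg.relLen hgen hBG b) →
      (((upTower hc hRa hν h0 b).nearLocus N (c b).pt n).Infinite ∧ IsIrreducible ((upTower hc hRa hν h0 b).nearLocus N (c b).pt n)) ∨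
      (((upTower hc hRa hν h0 b).nearLocus N (c b).pt n).Finite ∧
        ∀ y ∈ (upTower hc hRa hν h0 b).nearLocus N (c b).pt n, IsClosed ({y} : Set (c (b + n)).W)))
    (hReg : ∀ n, 0 < n → n < Seg.relIdxU hgen hBG b (Seg.relLen hgen hBG b) → ((upTower hc hRa hν h0 b).nearLocus N (c b).pt n).Infinite →
      ∀ h : IsClosed ((upTower hc hRa hν h0 b).nearLocus N (c b).pt n),
        Scheme.IsRegular (Scheme.IdealSheafData.vanishingIdeal ⟨(upTower hc hRa hν h0 b).nearLocus N (c b).pt n, h⟩).subscheme)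
    (hemp : HEmpU hc hRa hν h0 hgen hBG b) {q : ℕ} (hq : q < unitLen hgen hBG b) :
    (unitTowerU hc hRa hν h0 hgen hBG b hemp).C q = (unitTowerU hc hRa hν h0 hgen hBG b hemp).nearLocus N (basePt hc hRa hν h0 b) q := by
  haveI : IsLocallyNoetherian ((upTower hc hRa hν h0 b).X 0) := (upTower hc hRa hν h0 b).ln 0
  haveI := flat_fromSpecStalk ((upTower hc hRa hν h0 b).X 0) ((c b).pt : (upTower hc hRa hν h0 b).X 0)
  obtain ⟨k', _, _, hg⟩ := hX.exists_stateGood_of_reaches hRa hν (reaches_chain hreach hc b)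
  have hU := stratumIsolated_of_iso hg hiso
  -- the kept stage `relIdxU q` is blown up and lies inside the unit
  have hlt : Seg.relIdxU hgen hBG b q < Seg.relIdxU hgen hBG b (Seg.relLen hgen hBG b) := BlowupTower.cidx_strictMono 0 _ hq
  have hBq : (c (b + Seg.relIdxU hgen hBG b q)).IsBlownUp R N ν := Seg.B_add_relIdxU hgen hBG hb hq.le
  have hNC := nearLocus_subset_centre_of_isBlownUp hc hRf hRa hν h0 hX hreach b hb hiso _ hDich hReg _ hlt hBq
  have hN : ∀ n, (locTower hc hRa hν h0 b).nearLocus N (basePt hc hRa hν h0 b) n =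
      (locι hc hRa hν h0 b n).base ⁻¹' (upTower hc hRa hν h0 b).nearLocus N (c b).pt n := by
    intro n
    have h := (upTower hc hRa hν h0 b).nearLocus_baseChange
      (((upTower hc hRa hν h0 b).X 0).fromSpecStalk ((c b).pt : (upTower hc hRa hν h0 b).X 0)) N (basePt hc hRa hν h0 b) n
    rw [show (((upTower hc hRa hν h0 b).X 0).fromSpecStalk ((c b).pt : (upTower hc hRa hν h0 b).X 0)).base (basePt hc hRa hν h0 b) = (c b).pt
      from Scheme.fromSpecStalk_closedPoint] at h
    exact h
  rw [unitTowerU_C, locTower_C_eq_preimage_nearLocus hc hRa hν h0 hX hreach b hU _ hNC, ← hN]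
  exact ((locTower hc hRa hν h0 b).nearLocus_compress_zero (htriv_of_hEmpU hc hRa hν h0 hgen hBG hemp) N (basePt hc hRa hν h0 b) q).symm

include hRf hX hreach in
/-- **THE CENTRE DISCIPLINE OF THE REPAIRED UNIT TOWER FROM GEOMETRY**: clause (iii) from (Dich)/(RegN) (`unitTowerU_C_eq_nearLocus`); the
clauses (ii)′ `C_1 = ℙ(Dir_x)`, (iv) `C_{j+1} ⥲ C_j`, (v) non-surjectivity are taken as hypotheses (recognition geometry).
[cite: CossartJannsenSaito2020, Def. 6.38 (ii)–(v)] -/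
theorem unitCentreDiscipline_of_geometry (b : ℕ) (hb : (c b).IsBlownUp R N ν) (hiso : Iso N (c b))
    (hDich : ∀ n, 0 < n → n < Seg.relIdxU hgen hBG b (Seg.relLen hgen hBG b) →
      (((upTower hc hRa hν h0 b).nearLocus N (c b).pt n).Infinite ∧ IsIrreducible ((upTower hc hRa hν h0 b).nearLocus N (c b).pt n)) ∨
      (((upTower hc hRa hν h0 b).nearLocus N (c b).pt n).Finite ∧
        ∀ y ∈ (upTower hc hRa hν h0 b).nearLocus N (c b).pt n, IsClosed ({y} : Set (c (b + n)).W)))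
    (hReg : ∀ n, 0 < n → n < Seg.relIdxU hgen hBG b (Seg.relLen hgen hBG b) → ((upTower hc hRa hν h0 b).nearLocus N (c b).pt n).Infinite →
      ∀ h : IsClosed ((upTower hc hRa hν h0 b).nearLocus N (c b).pt n),
        Scheme.IsRegular (Scheme.IdealSheafData.vanishingIdeal ⟨(upTower hc hRa hν h0 b).nearLocus N (c b).pt n, h⟩).subscheme)
    (hemp : HEmpU hc hRa hν h0 hgen hBG b)
    (hone : 2 ≤ unitLen hgen hBG b →
      (unitTowerU hc hRa hν h0 hgen hBG b hemp).C 1 = (unitTowerU hc hRa hν h0 hgen hBG b hemp).projDir (basePt hc hRa hν h0 b))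
    (hisoC : ∀ j : ℕ, 1 ≤ j → j + 1 < unitLen hgen hBG b →
      InducesIsoOn ((unitTowerU hc hRa hν h0 hgen hBG b hemp).π j) ((unitTowerU hc hRa hν h0 hgen hBG b hemp).C (j + 1))
        ((unitTowerU hc hRa hν h0 hgen hBG b hemp).isClosed_C (j + 1)) ((unitTowerU hc hRa hν h0 hgen hBG b hemp).C j)
        ((unitTowerU hc hRa hν h0 hgen hBG b hemp).isClosed_C j))
    (hns : ∀ j : ℕ, 1 ≤ j → unitLen hgen hBG b = j + 1 →
      ¬ ((unitTowerU hc hRa hν h0 hgen hBG b hemp).C j ⊆ ((unitTowerU hc hRa hν h0 hgen hBG b hemp).π j).base ''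
        (unitTowerU hc hRa hν h0 hgen hBG b hemp).nearLocus N (basePt hc hRa hν h0 b) (j + 1))) :
    UnitCentreDiscipline (unitTowerU hc hRa hν h0 hgen hBG b hemp) N (unitLen hgen hBG b) (basePt hc hRa hν h0 b) :=
  ⟨hone, fun _ _ hqm => unitTowerU_C_eq_nearLocus hc hRf hRa hν h0 hgen hBG hX hreach b hb hiso hDich hReg hemp (Nat.lt_of_succ_le hqm),
    hisoC, hns⟩

end Unit

/-! ## The recognition row as pure geometry -/

/-- [OURS · L1 W4.2] **THE RECOGNITION ROW AS PURE GEOMETRY** over an origin predicate `Q` (stub-2 / res-D-pv-038's object, final shape): after the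
binder list of `UnitTowerExtractionLocAtQM p Q` and the auxiliary data of the extraction, AT EVERY BLOWN-UP ISOLATED STAGE `b`, with `N_n` the near
locus over `x_b` at stage `b + n` and `M = Seg.relIdxU b (relLen b)` the relative index of the next blown-up isolated stage:
(Dich) for `0 < n < M`, `N_n` is an infinite irreducible set or a finite set of closed points; (RegN) for `0 < n < M`, if `N_n` is infinite its
reduced closed subscheme is regular (the `ν`-lines `≅ ℙ¹`, CJS p. 105); and, for the repaired unit tower (whose (H-emp) then holds,
`Seg.hEmpU_of_nearLocus_geometry`), the clauses (ii)′ `C_1 = ℙ(Dir_x)` (Thm. 3.14 / Lemma 6.33 territory), (iv) `C_{j+1} ⥲ C_j`, (v)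
non-surjectivity at the end. All proof arguments are irrelevant. [cite: CossartJannsenSaito2020, Def. 6.38, Lemma 6.33, Thm. 3.14, p. 105] -/
def UnitGeometryAtQM (p : ℕ) (Q : ℕ → (ℕ → ℕ) → ∀ X : Scheme.{0}, X → Prop) : Prop :=
  ∀ (R : ∀ S : Scheme.{0}, CentreSeq S → Prop) (hRf : OracleFunctional R) (hRa : OracleAdmissible R)
    (ν : ℕ → ℕ) (X : Scheme.{0}) [IsLocallyNoetherian X] (x : X) (hX : IsMaximalOrigin p 3 ν X x), Q 3 ν X x →
  ∀ (c : ℕ → MarkedStage.{0}) (hreach : Reaches R 3 ν (MarkedStage.init X x) (c 0))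
    (hc : ∀ n, CanonicalNearStep R 3 ν (c n) (c (n + 1))), (∀ n, (c n).geomDirDim ≤ 2) →
    ∀ (hgen : ∀ n, ∃ m, n ≤ m ∧ (c m).IsBlownUp R 3 ν), (∀ n, ∃ m, n ≤ m ∧ Iso 3 (c m)) →
    (∀ n, Iso 3 (c n) → dirDim (c n) = 2 ∧ (c n).geomDirDim = 2) →
    ∀ (k : Type) (_ : Field k) (h0 : Helpers.CycleInv k 3 ν (c 0)) (hν : ν ≠ iterPSum 3 Phi)
      (hBG : ∀ n, ∃ m, n ≤ m ∧ (c m).IsBlownUp R 3 ν ∧ Iso 3 (c m)) (b : ℕ) (hb : (c b).IsBlownUp R 3 ν) (hiso : Iso 3 (c b)),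
      ∃ (hDich : ∀ n, 0 < n → n < Seg.relIdxU hgen hBG b (Seg.relLen hgen hBG b) →
          (((Seg.upTower hc hRa hν h0 b).nearLocus 3 (c b).pt n).Infinite ∧
              IsIrreducible ((Seg.upTower hc hRa hν h0 b).nearLocus 3 (c b).pt n)) ∨
          (((Seg.upTower hc hRa hν h0 b).nearLocus 3 (c b).pt n).Finite ∧
            ∀ y ∈ (Seg.upTower hc hRa hν h0 b).nearLocus 3 (c b).pt n, IsClosed ({y} : Set (c (b + n)).W)))
        (hReg : ∀ n, 0 < n → n < Seg.relIdxU hgen hBG b (Seg.relLen hgen hBG b) →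
          ((Seg.upTower hc hRa hν h0 b).nearLocus 3 (c b).pt n).Infinite →
          ∀ h : IsClosed ((Seg.upTower hc hRa hν h0 b).nearLocus 3 (c b).pt n),
            Scheme.IsRegular (Scheme.IdealSheafData.vanishingIdeal ⟨(Seg.upTower hc hRa hν h0 b).nearLocus 3 (c b).pt n, h⟩).subscheme),
      let he : Seg.HEmpU hc hRa hν h0 hgen hBG b := Seg.hEmpU_of_nearLocus_geometry hc hRf hRa hν h0 hgen hBG hX hreach b hb hiso hDich hReg
      (2 ≤ Seg.unitLen hgen hBG b →
        (Seg.unitTowerU hc hRa hν h0 hgen hBG b he).C 1 = (Seg.unitTowerU hc hRa hν h0 hgen hBG b he).projDir (Seg.basePt hc hRa hν h0 b)) ∧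
      (∀ j : ℕ, 1 ≤ j → j + 1 < Seg.unitLen hgen hBG b →
        InducesIsoOn ((Seg.unitTowerU hc hRa hν h0 hgen hBG b he).π j) ((Seg.unitTowerU hc hRa hν h0 hgen hBG b he).C (j + 1))
          ((Seg.unitTowerU hc hRa hν h0 hgen hBG b he).isClosed_C (j + 1)) ((Seg.unitTowerU hc hRa hν h0 hgen hBG b he).C j)
          ((Seg.unitTowerU hc hRa hν h0 hgen hBG b he).isClosed_C j)) ∧
      (∀ j : ℕ, 1 ≤ j → Seg.unitLen hgen hBG b = j + 1 →
        ¬ ((Seg.unitTowerU hc hRa hν h0 hgen hBG b he).C j ⊆ ((Seg.unitTowerU hc hRa hν h0 hgen hBG b he).π j).base ''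
          (Seg.unitTowerU hc hRa hν h0 hgen hBG b he).nearLocus 3 (Seg.basePt hc hRa hν h0 b) (j + 1)))

/-- **THE RECOGNITION ROW FROM PURE GEOMETRY**: `UnitGeometryAtQM p Q → UnitRecognitionAtQMU p Q` ((H-emp) within the unit by
`Seg.hEmpU_of_nearLocus_geometry`, clause (iii) by `unitTowerU_C_eq_nearLocus`). Hence
`Moving.unitTowerExtractionLocQM_of_recognitionU (unitRecognitionAtQMU_of_geometry h) : UnitTowerExtractionLocQM p` for
`h : UnitGeometryAtQM p (QCharRegime p)`, and likewise the characteristic-free / any-`Q` forms. [cite: CossartJannsenSaito2020, Def. 6.38] -/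
theorem unitRecognitionAtQMU_of_geometry (p : ℕ) (Q : ℕ → (ℕ → ℕ) → ∀ X : Scheme.{0}, X → Prop) (h : UnitGeometryAtQM p Q) :
    UnitRecognitionAtQMU p Q := by
  intro R hRf hRa ν X _ x hX hq c hreach hc hē hgen hIso h22 k _ h0 hν hBG b hb hiso
  obtain ⟨hDich, hReg, hone, hisoC, hns⟩ := h R hRf hRa ν X x hX hq c hreach hc hē hgen hIso h22 k inferInstance h0 hν hBG b hb hiso
  exact ⟨Seg.hEmpU_of_nearLocus_geometry hc hRf hRa hν h0 hgen hBG hX hreach b hb hiso hDich hReg,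
    unitCentreDiscipline_of_geometry hc hRf hRa hν h0 hgen hBG hX hreach b hb hiso hDich hReg _ hone hisoC hns⟩

/-- **THE (F1)-REGIME EXTRACTION FROM PURE GEOMETRY.** [cite: CossartJannsenSaito2020, Def. 6.38, Def. 6.39, Thm. 6.40, p. 107] -/
theorem _root_.Summit.ResolutionOfSingularities.ResolutionOfSingularities.Theorems.SigmaMaxModificationsCorridor3.Moving.unitTowerExtractionLocQM_of_geometry
    (p : ℕ) (h : UnitGeometryAtQM p (QCharRegime p)) : UnitTowerExtractionLocQM p :=
  unitTowerExtractionLocQM_of_recognitionU p (unitRecognitionAtQMU_of_geometry p _ h)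

end Seg

end Summit.ResolutionOfSingularities.ResolutionOfSingularities.Theorems.SigmaMaxModificationsCorridor3.Moving

end
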